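import Literature.NumberTheory.NumberFields.CyclicQuinticField11Primes
import Literature.NumberTheory.NumberFields.QuinticRing
import Mathlib.Data.ZMod.Basic
import HarnessLib

/-!
# The cyclic quintic field of conductor `11`: the computable model `(ℤ/4)[t]/(f)` and the finite checks

Continuation of `CyclicQuinticField11*.lean` (`K = ℚ(θ)`, `θ⁵ + θ⁴ - 4θ³ - 3θ² + 3θ + 1 = 0`,
`𝓞 K = ℤ[θ]`, `(2)` inert). This file provides the finite, *computable* quotient ring
`𝓞 K/4 = (ℤ/4)[t]/(f)` (the tree's `QuinticRing (ZMod 4) 3 1 3 0 3`: `t⁵ = -1 - 3t + 3t² + 4t³ - t⁴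
≡ 3 + t + 3t² + 0·t³ + 3t⁴`) used for the `2`-adic part of the explicit `2`-descent of
`480a1 : y² = x(x+2)(x-3)` over `K` (`CyclicQuinticField11Descent.lean`), one of the six quintic fields
entering the `n = 5` example of Dokchitser–Dokchitser [DokchitserDokchitser2011RankModN, proof of Thm. 2]
(`rk 480a1/F₅ = 1`, obtained there by a Magma `2`-descent over the minimal subfields of `F₅`).
Why modulo `4` suffices here (and not `8` as over the cubic fields): a unit of `𝓞/4` is a square
iff it is a square modulo `2`-adically relevant data `(λ, ·)`, and the fifteen candidate unit classes
all have `λ ≠ 0, 1` — concretely, the three finite checks below already fail modulo `4`.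

## Contents

* `QuinticRing.map`: coefficientwise functoriality of `QuinticRing` in the base ring (a ring
  homomorphism `QuinticRing R p → QuinticRing S (g p)`).
* `Q4 = QuinticRing (ZMod 4) 3 1 3 0 3`, `t`, `t_rel`, `exists_ψ₄ : ∃ ψ : 𝓞 K →+* Q4, ψ θ = t`;
  `Q2 = 𝓞/2 = 𝔽₃₂`, `red42 : Q4 →+* Q2`, `IsOdd` (= non-zero in `𝔽₃₂`, `isOdd_iff_red42_ne_zero`),
  `isOdd_of_not_two_dvd` (the kernel of `𝓞 K → 𝔽₃₂` is the maximal ideal `(2)`).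
* The tables `oddSq4` (the `31` squares of odd elements of `𝓞/4`, a group) and `sq4` (all `32`
  squares), complete by `decide +kernel` over the `1024` elements (`sq_mem_oddSq4`, `sq_mem_sq4`).
* The images `ηQ i` of the units `η_i = σⁱθ` and of their inverses, the `32` products
  `repQ n = ∏ ηQ i ^ bit n i` and the fifteen candidates `candN` (non-zero `n < 32` of even weight:
  the non-trivial unit classes of norm `+1`).
* The three finite checks (stated as `Bool` computations over lists, evaluated by the kernel):
  `closure_check` (`oddSq4` is closed under products and `S ↦ S⁻¹ = S³⁰`), `cand_check`
  (`repQ n · repQinv n = 1` and `repQ n ∉ oddSq4`: **no candidate unit is a square modulo `4`**), and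
  `main_check` (for `u = repQ n`, `S ∈ oddSq4`: `uS + 2 ∈ oddSq4 ⟹ S - 3u⁻¹ ∉ sq4`), with their
  propositional forms `no_solution_neg` (`uS ≠ S'`) and `no_solution_main`
  (`uS + 2 = S'`, `uS - 3 = uS''` impossible for `S, S'` odd squares and `S''` a square) — the
  `2`-adic obstruction, cf. [SilvermanAEC2009, Ch. X §1, Prop. X.1.4 and Example X.1.5] for the method.

All statements tagged [folklore] are routine finite computations; the two tables were generated by
enumerating `(ℤ/4)⁵` externally and are *verified* here by the kernel.
-/

open Polynomial

namespace Literature.NumberTheory.NumberFields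

namespace QuinticRing

variable {R S : Type*} [CommRing R] [CommRing S] {p0 p1 p2 p3 p4 : R}

/-- **Functoriality of `QuinticRing` in the coefficient ring**: a ring homomorphism `g : R → S`
induces `QuinticRing R p → QuinticRing S (g p)` coefficientwise. [folklore] -/
def map (g : R →+* S) :
    QuinticRing R p0 p1 p2 p3 p4 →+* QuinticRing S (g p0) (g p1) (g p2) (g p3) (g p4) where
  toFun u := ⟨g u.c0, g u.c1, g u.c2, g u.c3, g u.c4⟩
  map_zero' := by ext <;> simp
  map_one' := by ext <;> simp
  map_add' u v := by ext <;> simp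
  map_mul' u v := by
    ext <;> simp only [mul_c0, mul_c1, mul_c2, mul_c3, mul_c4, q0, q1, q2, q3, map_add, map_mul]

/-- Unfolding `map`. [folklore] -/
@[simp] theorem map_apply (g : R →+* S) (u : QuinticRing R p0 p1 p2 p3 p4) :
    map g u = ⟨g u.c0, g u.c1, g u.c2, g u.c3, g u.c4⟩ := rfl

end QuinticRing

namespace CyclicQuintic11

open NumberField

/-! ### The ring `𝓞/4 = (ℤ/4)[t]/(f)` -/

/-- **`Q4 = 𝓞 K/4 = (ℤ/4)[t]/(t⁵ + t⁴ - 4t³ - 3t² + 3t + 1)`** as the tree's computable `QuinticRing`: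
`t⁵ = 3 + t + 3t² + 0·t³ + 3t⁴` over `ℤ/4`. [folklore] -/
abbrev Q4 : Type := QuinticRing (ZMod 4) 3 1 3 0 3

/-- The element `t` (class of `X`). [folklore] -/
def t : Q4 := QuinticRing.gen (ZMod 4) 3 1 3 0 3

/-- `t` is a root of `f` in `Q4` (by computation). [folklore] -/
theorem t_rel : t ^ 5 + t ^ 4 - 4 * t ^ 3 - 3 * t ^ 2 + 3 * t + 1 = 0 := by decide +kernel

/-- **The reduction map `ψ₄ : 𝓞 K → 𝓞 K/4`, `θ ↦ t`** (a ring homomorphism; we never need its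
kernel). [folklore] -/
theorem exists_ψ₄ : ∃ ψ : 𝓞 K →+* Q4, ψ θint = t := exists_ringHom_apply_θint t t_rel

/-- The reduction `ℤ/4 → ℤ/2`. [folklore] -/
abbrev cast42 : ZMod 4 →+* ZMod 2 := ZMod.castHom (by norm_num : 2 ∣ 4) (ZMod 2)

/-- **`Q2 = 𝓞 K/2 = 𝔽₂[t]/(f) = 𝔽₃₂`** (the structure constants are the reductions of those of
`Q4`, so that `red42` below is literally `QuinticRing.map`). [folklore] -/
abbrev Q2 : Type := QuinticRing (ZMod 2) (cast42 3) (cast42 1) (cast42 3) (cast42 0) (cast42 3)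

/-- The reduction `𝓞/4 → 𝓞/2`. [folklore] -/
def red42 : Q4 →+* Q2 := QuinticRing.map cast42

/-- `Q2 = 𝔽₃₂` is non-trivial. [folklore] -/
instance : Nontrivial Q2 := ⟨⟨0, 1, by decide +kernel⟩⟩

/-- **"Odd" elements of `𝓞/4`**: some coefficient is odd, i.e. non-zero image in `𝓞/2 = 𝔽₃₂`
(these are exactly the units of `𝓞/4`). [folklore] -/
def IsOdd (u : Q4) : Prop :=
  u.c0.val % 2 = 1 ∨ u.c1.val % 2 = 1 ∨ u.c2.val % 2 = 1 ∨ u.c3.val % 2 = 1 ∨ u.c4.val % 2 = 1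

/-- Oddness is decidable. [folklore] -/
instance : DecidablePred IsOdd := fun u => by unfold IsOdd; infer_instance

/-- Oddness is non-vanishing in `𝔽₃₂` under `red42` (by computation over the `1024` elements).
[folklore] -/
theorem isOdd_iff_red42_ne_zero : ∀ u : Q4, IsOdd u ↔ red42 u ≠ 0 := by decide +kernel

/-- A ring homomorphism `𝓞 K → 𝔽₃₂ = Q2` has kernel `(2)`: it kills `2`, `(2)` is maximal, and
the target is non-trivial. [folklore] -/
theorem ker_eq_span_two (φ : 𝓞 K →+* Q2) : RingHom.ker φ = Ideal.span {(2 : 𝓞 K)} := by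
  have h := ker_eq_span_of_map_natCast (p := 2) (Or.inl rfl) φ (by
    rw [Nat.cast_ofNat, map_ofNat]; decide +kernel)
  simpa using h

/-- **Odd elements reduce to odd quintuples**: if `z ∈ 𝓞 K` is not divisible by `2` then `ψ₄ z` is
odd (its image in `𝔽₃₂` under `red42 ∘ ψ₄`, a homomorphism with kernel `(2)`, is non-zero).
[folklore] -/
theorem isOdd_of_not_two_dvd (ψ : 𝓞 K →+* Q4) {z : 𝓞 K} (hz : ¬ (2 : 𝓞 K) ∣ z) : IsOdd (ψ z) := by
  rw [isOdd_iff_red42_ne_zero]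
  intro h0
  apply hz
  have hmem : z ∈ RingHom.ker (red42.comp ψ) := by rw [RingHom.mem_ker, RingHom.comp_apply]; exact h0
  rw [ker_eq_span_two, Ideal.mem_span_singleton] at hmem
  exact hmem

/-! ### The squares of `𝓞/4` -/

/-- The `31` squares of odd elements of `𝓞/4` (coordinates on `1, t, …, t⁴`); the square of an odd
element only depends on it modulo `2`, whence `31 = |𝔽₃₂ˣ|` of them. [folklore] -/
def oddSq4 : List Q4 := [⟨0, 0, 0, 0, 1⟩, ⟨0, 0, 1, 0, 0⟩, ⟨0, 0, 1, 2, 1⟩, ⟨0, 0, 2, 1, 0⟩, ⟨0, 1, 0, 3, 3⟩, ⟨0, 1, 3, 2, 0⟩, ⟨0, 2, 3, 3, 2⟩, ⟨0, 3, 3, 1, 2⟩, ⟨0, 3, 3, 2, 3⟩, ⟨1, 0, 0, 0, 0⟩, ⟨1, 0, 2, 0, 1⟩, ⟨1, 1, 2, 2, 2⟩, ⟨1, 1, 2, 3, 1⟩, ⟨1, 1, 3, 1, 0⟩, ⟨1, 2, 1, 0, 0⟩, ⟨1, 2, 2, 3, 1⟩, ⟨1, 2, 3, 2, 1⟩, ⟨1,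 2, 3, 3, 3⟩, ⟨1, 3, 0, 0, 1⟩, ⟨2, 0, 3, 1, 3⟩, ⟨2, 1, 0, 0, 0⟩, ⟨2, 1, 0, 1, 0⟩, ⟨2, 2, 2, 1, 1⟩, ⟨2, 3, 0, 2, 3⟩, ⟨2, 3, 3, 1, 1⟩, ⟨3, 0, 0, 3, 0⟩, ⟨3, 0, 1, 1, 2⟩, ⟨3, 1, 0, 1, 2⟩, ⟨3, 1, 1, 1, 3⟩, ⟨3, 1, 3, 0, 1⟩, ⟨3, 3, 1, 0, 2⟩]

/-- All `32` squares of `𝓞/4` (`oddSq4` and `0`). [folklore] -/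
def sq4 : List Q4 := [⟨0, 0, 0, 0, 0⟩, ⟨0, 0, 0, 0, 1⟩, ⟨0, 0, 1, 0, 0⟩, ⟨0, 0, 1, 2, 1⟩, ⟨0, 0, 2, 1, 0⟩, ⟨0, 1, 0, 3, 3⟩, ⟨0, 1, 3, 2, 0⟩, ⟨0, 2, 3, 3, 2⟩, ⟨0, 3, 3, 1, 2⟩, ⟨0, 3, 3, 2, 3⟩, ⟨1, 0, 0, 0, 0⟩, ⟨1, 0, 2, 0, 1⟩, ⟨1, 1, 2, 2, 2⟩, ⟨1, 1, 2, 3, 1⟩, ⟨1, 1, 3, 1, 0⟩, ⟨1, 2, 1, 0, 0⟩, ⟨1, 2, 2, 3, 1⟩, ⟨1, 2, 3, 2, 1⟩, ⟨1, 2, 3, 3, 3⟩, ⟨1, 3, 0, 0, 1⟩, ⟨2, 0, 3, 1, 3⟩, ⟨2, 1, 0, 0, 0⟩, ⟨2, 1, 0, 1, 0⟩, ⟨2, 2, 2, 1, 1⟩, ⟨2, 3, 0, 2, 3⟩, ⟨2, 3, 3, 1, 1⟩, ⟨3, 0, 0, 3, 0⟩, ⟨3, 0, 1, 1, 2⟩,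 ⟨3, 1, 0, 1, 2⟩, ⟨3, 1, 1, 1, 3⟩, ⟨3, 1, 3, 0, 1⟩, ⟨3, 3, 1, 0, 2⟩]

/-- Every odd square of `𝓞/4` is in `oddSq4` (by computation over the `1024` elements). [folklore] -/
theorem sq_mem_oddSq4 : ∀ u : Q4, IsOdd u → u * u ∈ oddSq4 := by decide +kernel

/-- Every square of `𝓞/4` is in `sq4` (by computation). [folklore] -/
theorem sq_mem_sq4 : ∀ u : Q4, u * u ∈ sq4 := by decide +kernel

/-! ### The images of the units `η_i` and the candidate classes -/

/-- The images in `𝓞/4` of the units `η_i = σⁱθ`: `t, t² - 2, t⁴ - 4t² + 2, t³ - 3t,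
-t⁴ - t³ + 3t² + 2t - 1`. [folklore] -/
def ηQ (i : Fin 5) : Q4 :=
  ![t, t ^ 2 - 2, t ^ 4 - 4 * t ^ 2 + 2, t ^ 3 - 3 * t, -t ^ 4 - t ^ 3 + 3 * t ^ 2 + 2 * t - 1] i

/-- The images in `𝓞/4` of the inverses `η_i⁻¹` (`CyclicQuinticField11Units.lean`). [folklore] -/
def ηQinv (i : Fin 5) : Q4 :=
  ![-(t ^ 4 + t ^ 3 - 4 * t ^ 2 - 3 * t + 3), t - 3 * t ^ 2 + t ^ 4, -3 * t - 3 * t ^ 2 + t ^ 3 + t ^ 4,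
    1 - t - t ^ 2, -1 + 3 * t ^ 2 - t ^ 4] i

/-- The image of the representative unit `rep n = ∏ η_i^{bit n i}` (as an explicit five-fold product,
for kernel evaluation). [folklore] -/
def repQ (n : Fin 32) : Q4 :=
  ηQ 0 ^ bit n 0 * ηQ 1 ^ bit n 1 * ηQ 2 ^ bit n 2 * ηQ 3 ^ bit n 3 * ηQ 4 ^ bit n 4

/-- The image of `(rep n)⁻¹`. [folklore] -/
def repQinv (n : Fin 32) : Q4 :=
  ηQinv 0 ^ bit n 0 * ηQinv 1 ^ bit n 1 * ηQinv 2 ^ bit n 2 * ηQinv 3 ^ bit n 3 * ηQinv 4 ^ bit n 4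

/-- `repQ` as a product over `Fin 5`. [folklore] -/
theorem repQ_eq_prod (n : Fin 32) : repQ n = ∏ i, ηQ i ^ bit n i := by
  rw [repQ, Fin.prod_univ_five]

/-- **The fifteen candidates**: the non-zero `n < 32` of even binary weight (the exponent patterns of
the non-trivial unit classes `∏ η_i^{bᵢ}` of norm `(-1)^{Σ bᵢ} = +1`). [folklore] -/
def candN : List (Fin 32) := [3, 5, 6, 9, 10, 12, 15, 17, 18, 20, 23, 24, 27, 29, 30]

/-- Every non-zero `n < 32` with `Σᵢ bit n i` even is a candidate (by computation). [folklore] -/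
theorem mem_candN : ∀ n : Fin 32, n ≠ 0 →
    2 ∣ bit n 0 + bit n 1 + bit n 2 + bit n 3 + bit n 4 → n ∈ candN := by
  decide +kernel

/-- The weight as a sum over `Fin 5`. [folklore] -/
theorem sum_bit_eq (n : Fin 32) : ∑ i, bit n i = bit n 0 + bit n 1 + bit n 2 + bit n 3 + bit n 4 := by
  rw [Fin.sum_univ_five]

/-! ### The three finite checks -/

/-- **`oddSq4` is a group**: closed under products and under `S ↦ S³⁰ = S⁻¹`
(an odd square lies in the cyclic group of order `31` of Teichmüller-type classes: `S³¹ = 1`), by kernel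
computation. [folklore] -/
theorem closure_check :
    (oddSq4.all fun s => (s * s ^ 30 == 1) && List.elem (s ^ 30) oddSq4 &&
      oddSq4.all fun s' => List.elem (s * s') oddSq4) = true := by
  decide +kernel

/-- **No candidate unit is an odd square modulo `4`**, and `repQinv n` is its inverse (by kernel
computation). [folklore] -/
theorem cand_check :
    (candN.all fun n => (repQ n * repQinv n == 1) && !(List.elem (repQ n) oddSq4)) = true := by
  decide +kernel

/-- **The main check** (case `ord₂(x) = 0` of the descent): for every candidate `u = repQ n` and every
odd square `S`, if `uS + 2` is an odd square then `S - 3u⁻¹` is not a square, in `𝓞/4` (by kernel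
computation over the `15 × 31` pairs). [folklore] -/
theorem main_check :
    (candN.all fun n => oddSq4.all fun s =>
      !(List.elem (repQ n * s + 2) oddSq4) || !(List.elem (s - 3 * repQinv n) sq4)) = true := by
  decide +kernel

/-! ### Propositional forms -/

/-- `oddSq4` is closed under multiplication. [folklore] -/
theorem mul_mem_oddSq4 {s s' : Q4} (hs : s ∈ oddSq4) (hs' : s' ∈ oddSq4) : s * s' ∈ oddSq4 := by
  have h := closure_check
  simp only [List.all_eq_true, Bool.and_eq_true] at h
  exact List.mem_of_elem_eq_true ((h s hs).2 s' hs')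

/-- Inverses in `oddSq4`: `S · S³⁰ = 1` and `S³⁰ ∈ oddSq4`. [folklore] -/
theorem inv_mem_oddSq4 {s : Q4} (hs : s ∈ oddSq4) : s * s ^ 30 = 1 ∧ s ^ 30 ∈ oddSq4 := by
  have h := closure_check
  simp only [List.all_eq_true, Bool.and_eq_true, beq_iff_eq] at h
  exact ⟨(h s hs).1.1, List.mem_of_elem_eq_true (h s hs).1.2⟩

/-- For a candidate `n`: `repQ n · repQinv n = 1` and `repQ n ∉ oddSq4`. [folklore] -/
theorem cand_spec {n : Fin 32} (hn : n ∈ candN) : repQ n * repQinv n = 1 ∧ repQ n ∉ oddSq4 := by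
  have h := cand_check
  simp only [List.all_eq_true, Bool.and_eq_true, beq_iff_eq, Bool.not_eq_true'] at h
  refine ⟨(h n hn).1, fun hmem => ?_⟩
  have := List.elem_eq_true_of_mem hmem
  rw [(h n hn).2] at this
  exact Bool.false_ne_true this

/-- **Case `ord₂(x) < 0`**: `u · S ≠ S'` for a candidate `u` and odd squares `S, S'` in `𝓞/4`
(otherwise `u = S' · S⁻¹` would be an odd square). [folklore] -/
theorem no_solution_neg {n : Fin 32} (hn : n ∈ candN) {S S' : Q4} (hS : S ∈ oddSq4) (hS' : S' ∈ oddSq4) :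
    repQ n * S ≠ S' := by
  intro h
  obtain ⟨hinv, hmem⟩ := inv_mem_oddSq4 hS
  apply (cand_spec hn).2
  have e : repQ n = S' * S ^ 30 := by
    calc repQ n = repQ n * (S * S ^ 30) := by rw [hinv, mul_one]
      _ = repQ n * S * S ^ 30 := by ring
      _ = S' * S ^ 30 := by rw [h]
  rw [e]
  exact mul_mem_oddSq4 hS' hmem

/-- **Case `ord₂(x) = 0`**: `uS + 2 = S'` and `uS - 3 = uS''` have no solution with `S, S'` odd squares
and `S''` a square in `𝓞/4`, for a candidate `u` (multiply the second equation by `u⁻¹`).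
[folklore] -/
theorem no_solution_main {n : Fin 32} (hn : n ∈ candN) {S S' S'' : Q4} (hS : S ∈ oddSq4)
    (hS' : S' ∈ oddSq4) (hS'' : S'' ∈ sq4) (h1 : repQ n * S + 2 = S')
    (h2 : repQ n * S - 3 = repQ n * S'') : False := by
  have h := main_check
  simp only [List.all_eq_true, Bool.or_eq_true, Bool.not_eq_true'] at h
  have hinv := (cand_spec hn).1
  rcases h n hn S hS with h' | h'
  · have := List.elem_eq_true_of_mem (h1 ▸ hS' : repQ n * S + 2 ∈ oddSq4)
    rw [h'] at this
    exact Bool.false_ne_true this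
  · have e : S - 3 * repQinv n = S'' := by
      calc S - 3 * repQinv n = repQinv n * repQ n * S - 3 * repQinv n := by rw [mul_comm (repQinv n), hinv, one_mul]
        _ = repQinv n * (repQ n * S - 3) := by ring
        _ = repQinv n * (repQ n * S'') := by rw [h2]
        _ = repQinv n * repQ n * S'' := by ring
        _ = S'' := by rw [mul_comm (repQinv n), hinv, one_mul]
    have := List.elem_eq_true_of_mem (e ▸ hS'' : S - 3 * repQinv n ∈ sq4)
    rw [h'] at this
    exact Bool.false_ne_true this

end CyclicQuintic11

end Literature.NumberTheory.NumberFields
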